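import Summits.HodgeConjecture.HodgeConjecture.Theorems.H413ThetaDistAtLine
import Summits.HodgeConjecture.HodgeCM.Model.ArchKTypeOfDist
import Summits.HodgeConjecture.HodgeCM.Model.ArchKTypeOfDistHol_1
import Summits.HodgeConjecture.HodgeCM.Model.ArchKTypeOfLambda
import Summits.HodgeConjecture.HodgeCM.Model.ArchKTypeOfLineTables
import Summits.HodgeConjecture.HodgeCM.Model.ThetaAdelicSideGuardedT_1
import HarnessLib

/-!
# FLOOR-0 P4, S4b (4) ∕ PLAN v2 §6 (b) — the archimedean ∕ analytic rows of the model datum AT THE LINE `a` (`sideAt`, `distDatumAt`),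
# reduced to two archimedean-type conditions on the knob character

Cell hodgecm-mathlib (D-0151), FLOOR 0, crux item H413 = stmt-HodgeConjecture-24833; programme P4, line
`Cruxes/H413/Lines/F0_P4AdmissibleOccursInH1.lean` (ED. 2), stub S4b `stub_T3a_holThetaAtAdmissibleLineOfRallisAt` (lead F0P4-p01 (g0)).  Author F0P4-p04
(g0).  `--supports stmt-HodgeConjecture-24833 --as helper`.  KERNEL ONLY: theorems composing LANDED model-layer theorems at the degenerate seesaw
context `cDiag Φ σ a` of ★ `Theorems/H413ThetaDistAtLine`; nothing is cited as a fact, no `sorry`, no definition.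

WHY.  ★ `H413ThetaDistAtLine.distDatumAt … hV Φarch harm hdef` (the slot-`0` theta-distribution datum at the line `a` over `sideAt … η hη hηc ν hν hνc A`) and
★ `H413ThetaDistDescent.exists_coinvLift_dist_sideAt … hLF hd hCR χ` (the descent to the `χ`-coinvariants, values in `holCotForms`) take SIX archimedean ∕
analytic inputs: `Φarch`, `harm`, `hdef`, `hLF`, `hd`, `hCR`.  At the model's pins of record these are discharged by character-GENERIC theorems of the model
layer plus two archimedean-TYPE rows of the pin's characters (`AdelicThetaDistributionMultPinG.pinDatumZeroG`: `hemb eR eS hχ a hω hdefI`; at the R2 pin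
`hχ := hχ_zero_ROGTC`, `hdefI := hdef_zero_ROGTC`).  This file is the same instantiation AT A GENERAL WEIGHT-ONE `μ`, i.e. for ARBITRARY knobs `(η, ν)` of
`sideAt` (junction J, F0P4-p01), for the slot family OF RECORD
`Φarch := blockFamilyOfAt … (lineVec a) … ι₁ (blockPosEquiv V) (blockNegEquiv V) (posIdxEquivUnit hpos) (negIdxEquivEmpty hpos) (degOnePDual Empty) (binvPi 1)`
(the harmonic `(1,0)`-vector at `ι₁` tensor the Gaussian at the definite places, #CA13), `hpos` = positivity of the line at `ι₁` (★ `Theorems/H413AdmissibleLineOrient`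
`cmXW_cmPlace_admissibleLine_pos_iff` at the admissible line):

* §1 **FREE rows** (no hypothesis on the knob): `isLFAction_sideAt` (★ `isLFAction_archSideOfT`), and — for every slot-`0` datum `D` over `sideAt` whose
  archimedean Weil representation is `lineOmega_zero … (etaT₀ … η ν)` and whose harmonic family is `Φarch` (both `rfl` for `distDatumAt`:
  ★ `distDatumAt_ωA`, `distDatumAt_Φarch`) — `hd_of_eq` ∕ `hCR_of_eq` (★ `hd_lineOmega_zeroG` ∕ `hCR_lineOmega_zeroG`, which are `η₀`-generic; inputs
  `hemb : (mk ι₁).embedding = ι₁` and `hpos` only).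
* §2 **the two SOCKETS**: `harm_cDiag_of_archType` — the `harm` input of `distDatumAt` from ONE integer `m`, the `v₁`-type of the knob character
  `η₀ := etaT₀ … η ν` on the `ι₁`-section frame (`hη`), and the numerology `m + ℓ + e_P = 0`, `m + ℓ + e_Q = −1` (`ℓ = lambdaExponent`, `(e_P, e_Q) =
  lineVacExponentsZero`, `e_P − e_Q = 1`) — ★ `harm_lineOmega_zeroG` ∘ ★ `hχ_zero_of_archType`; and `hdef_cDiag_of_defType` — the `hdef` input of
  `distDatumAt` from the DEFINITE types of `η₀` (`hdefT`: at every real place `b ≠ v₁`, `archScalar_zeroG … η₀ (archSingle b u) · det(u)^(a₀ b) = 1` for the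
  exponent table of record `a₀ := defExponentZero`) — ★ `harch_zero_of_defType_tmulG` with `hω := defExponentZero_spec`.
  These two archimedean-type conditions are the kernel form of «`μ_∞` has weight one of type `Φ_μ`» ([Liu2021, Lem. D.2 (2)]; [KonnoKonno2007, Thm 5.4]);
  they are discharged once the knob `(η, ν)` of junction J is fixed (pattern: ★ `hχ_zero_R1`, `hdef_zero_ROGTC`).
* §3 `distDatumAtOfTypes` is NOT defined here (no definitions in a proof file): the consumer writes
  `distDatumAt … hV Φarch (harm_cDiag_of_archType …) (hdef_cDiag_of_defType …)` and feeds `hd_of_eq … rfl rfl`, `hCR_of_eq … rfl rfl`, `isLFAction_sideAt … 0`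
  to `exists_coinvLift_dist_sideAt`.

NOT here: the archimedean test data `A : ∀ k, ArchLineInput …` of `sideAt` (knob-independent in constraint; next file), the knob itself (p01), non-vanishing (p02).
HC_CM is proved only modulo the printed citations until rung 0 closes.

## References
* Tree (model layer, all ★): `HodgeCM/Model/ThetaAdelicSideGuardedT` (`isLFAction_archSideOfT`), `HodgeCM/Model/ArchKTypeOfDistHol` (`hd_lineOmega_zeroG`,
  `hCR_lineOmega_zeroG`), `HodgeCM/Model/ArchKTypeOfDist` (`harm_lineOmega_zeroG`, `harch_zero_of_defType_tmulG`), `HodgeCM/Model/ArchKTypeOfLambda`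
  (`hχ_zero_of_archType`, `lambdaExponent`), `HodgeCM/Model/ArchKTypeOfLineTables` (`defExponentZero`, `defExponentZero_spec`), `HodgeCM/Model/ArchKTypeOfSlotRec`
  (`lineVacExponentsZero`), `HodgeCM/Model/AdelicThetaDistributionMultPinG` (the pins' pattern `pinDatumZeroG`), ★ `Theorems/H413ThetaDistAtLine`.
* [Liu2021] Y. Liu, Camb. J. Math. 9 (2021) = arXiv:2102.11518, App. D Lem. D.2 (1)(2), proof of Prop. 4.13 (l. 2145).
* [KonnoKonno2007] T. Konno, K. Konno, Kyushu J. Math. 61 (2007), Lem. 5.2, Thm. 5.4.  [BorelWallach2000] A. Borel, N. Wallach, AMS (2000), VII 2.10.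
-/

set_option autoImplicit false
set_option linter.dupNamespace false

noncomputable section

open NumberField hiding relNormOneIdeles relNormOneRat probHaarRelNormOneQuot
open _root_.NumberField.InfinitePlace _root_.NumberField.mixedEmbedding MeasureTheory MulAction IsDedekindDomain
open scoped Matrix TensorProduct Classical SchwartzMap
open Literature.Geometry.ComplexHyperbolic.BallModel (U21 x₀ stabilizerEquivK21)
open Literature.NumberTheory.Automorphic.U21 (K21 matA sclD)
open Literature.NumberTheory.Automorphic Literature.NumberTheory.Automorphic.UnitaryGroup Literature.NumberTheory.Weil1964
open Literature.NumberTheory.GelbartRogawski1991 Literature.NumberTheory.GelbartRogawski1991.UnitaryDualPair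
open Literature.AlgebraicGeometry.HodgeTheory Literature.AlgebraicGeometry.ShimuraVarieties Literature.AlgebraicGeometry.ShimuraVarieties.BallForms
open Literature.AlgebraicGeometry.Motives (CMType)
open Literature.RepresentationTheory.KonnoKonno2007 Literature.RepresentationTheory.KonnoKonno2007.RealDualPair
open Literature.Analysis.SegalBargmann
open HodgeCM HodgeCM.Adelic HodgeCM.PerL34 HodgeCM.Model HodgeCM.Model.HypCensus HodgeCM.Model.ArchSideTerm HodgeCM.Model.ThetaDistFin
open HodgeCM.Model.ThetaAdelicSide HodgeCM.Model.SupplyInstance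

namespace Summit.HodgeConjecture.HodgeConjecture.Cruxes.H413.ThetaDistAtLine

variable {L : CMField} {ι₁ : L →+* ℂ} (V : HermSpace3 L ι₁)
variable (Φ : CMType (L : Type)) (σ : (L : Type) →+* ℂ) (a : (L : Type)) (ha : IsCMField.complexConj (L : Type) a = a) (ha0 : a ≠ 0)
variable (η : CMAdelic (L : Type) (frameD V) × CMAdelic (L : Type) (dW (cDiag Φ σ a ha ha0).D) →* ℂˣ)
  (hη : ∀ γU ∈ CMRat (L : Type) (frameD V), ∀ γ ∈ CMRat (L : Type) (dW (cDiag Φ σ a ha ha0).D), η (γU, γ) = 1)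
  (hηc : Continuous fun p => ((η p : ℂˣ) : ℂ))
  (ν : CMAdelic (L : Type) (frameD V) →* ℂˣ)
  (hν : ∀ γU ∈ CMRat (L : Type) (frameD V), ν γU = 1)
  (hνc : Continuous fun v => ((ν v : ℂˣ) : ℂ))
  (A : ∀ k : Fin 4, ArchLineInput V (lineRepT V (cDiag Φ σ a ha ha0).D (compat_plane V Φ σ a ha ha0) (compat_line₀ V Φ σ a ha ha0)
    (compat_line₁ V Φ σ a ha ha0) (compat_line₂ V Φ σ a ha ha0) (compat_line₃ V Φ σ a ha ha0) η ν k))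
  (hV : IsAnisotropic L V.Hm)
  -- positivity of the line `a` at `ι₁` (★ `Theorems/H413AdmissibleLineOrient` at the admissible line) and the canonical representative of `ι₁`
  (hpos : 0 < cmXW (L : Type) (frameD V) (lineVec (L : Type) (dW (cDiag Φ σ a ha ha0).D 0)) (fun _ => dW_real (cDiag Φ σ a ha ha0).D 0) ι₁
    (HypCensus.cmPlace (L : Type) ι₁) 0)
  (hemb : (InfinitePlace.mk ι₁).embedding = ι₁)

/-! ## §1 The free rows: `hLF`, `hd`, `hCR` -/

/-- **`hLF` at the line `a`, for ANY knob `(η, ν)` and test data `A`**: every slot of `sideAt` is an LF-action (★ `isLFAction_archSideOfT`). -/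
theorem isLFAction_sideAt (k : Fin 4) : ((sideAt V Φ σ a ha ha0 η hη hηc ν hν hνc A).P k).IsLFAction :=
  isLFAction_archSideOfT V (cDiag Φ σ a ha ha0) (compat_plane V Φ σ a ha ha0) (compat_line₀ V Φ σ a ha ha0) (compat_line₁ V Φ σ a ha ha0)
    (compat_line₂ V Φ σ a ha ha0) (compat_line₃ V Φ σ a ha ha0) η hη hηc ν hν hνc (h₁W_cDiag Φ σ a ha ha0) A k

include hemb in
/-- **`hd` at the line `a`, for ANY knob**: for a slot-`0` datum `D` over `sideAt` whose archimedean Weil representation is `lineOmega_zero … (etaT₀ … η ν)` and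
whose harmonic family is the slot family of record (both `rfl` for `distDatumAt`), `b ↦ T (D.ωA (expP b) (D.Φarch ℓ))` is real-differentiable at `0`
(★ `hd_lineOmega_zeroG`, `η₀`-generic; inputs `hpos`, `hemb`). -/
theorem hd_of_eq (D : (sideAt V Φ σ a ha ha0 η hη hηc ν hν hνc A).ThetaDistDatum hV 0)
    (hDω : D.ωA = lineOmega_zero V (cDiag Φ σ a ha ha0).D (compat_plane V Φ σ a ha ha0) (compat_line₀ V Φ σ a ha ha0)
      (compat_line₁ V Φ σ a ha ha0) (etaT₀ V (cDiag Φ σ a ha ha0).D η ν))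
    (hDΦ : D.Φarch = blockFamilyOfAt (L : Type) e₁ (frameD V) (frameD_real V) (frameD_ne V) (lineVec (L : Type) (dW (cDiag Φ σ a ha ha0).D 0))
      (fun _ => dW_real (cDiag Φ σ a ha ha0).D 0) (fun _ => dW_ne (cDiag Φ σ a ha ha0).D 0) ι₁ (blockPosEquiv V) (blockNegEquiv V)
      (posIdxEquivUnit hpos) (negIdxEquivEmpty hpos) (degOnePDual Empty) (binvPi 1))
    (T : 𝓢((Fin 3 → mixedSpace (↥(maximalRealSubfield L))), ℂ) →L[ℂ] ℂ) (ℓ : Module.Dual ℂ (Fin 2 → ℂ)) :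
    DifferentiableAt ℝ (fun b => T (D.ωA (BallForms.expP b) (D.Φarch ℓ))) 0 := by
  rw [hDω, hDΦ]
  exact hd_lineOmega_zeroG V (cDiag Φ σ a ha ha0) (compat_plane V Φ σ a ha ha0) (compat_line₀ V Φ σ a ha ha0) (compat_line₁ V Φ σ a ha ha0)
    (etaT₀ V (cDiag Φ σ a ha ha0).D η ν) (h₁W_cDiag Φ σ a ha ha0) (binvPi 1) (posIdxEquivUnit hpos) (negIdxEquivEmpty hpos) hemb T ℓ

include hemb in
/-- **`hCR` at the line `a`, for ANY knob**: the scalarised differential at `0` of `b ↦ T (D.ωA (expP b) (D.Φarch ℓ))` is complex-linear (★ `hCR_lineOmega_zeroG`). -/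
theorem hCR_of_eq (D : (sideAt V Φ σ a ha ha0 η hη hηc ν hν hνc A).ThetaDistDatum hV 0)
    (hDω : D.ωA = lineOmega_zero V (cDiag Φ σ a ha ha0).D (compat_plane V Φ σ a ha ha0) (compat_line₀ V Φ σ a ha ha0)
      (compat_line₁ V Φ σ a ha ha0) (etaT₀ V (cDiag Φ σ a ha ha0).D η ν))
    (hDΦ : D.Φarch = blockFamilyOfAt (L : Type) e₁ (frameD V) (frameD_real V) (frameD_ne V) (lineVec (L : Type) (dW (cDiag Φ σ a ha ha0).D 0))
      (fun _ => dW_real (cDiag Φ σ a ha ha0).D 0) (fun _ => dW_ne (cDiag Φ σ a ha ha0).D 0) ι₁ (blockPosEquiv V) (blockNegEquiv V)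
      (posIdxEquivUnit hpos) (negIdxEquivEmpty hpos) (degOnePDual Empty) (binvPi 1))
    (T : 𝓢((Fin 3 → mixedSpace (↥(maximalRealSubfield L))), ℂ) →L[ℂ] ℂ) (ℓ : Module.Dual ℂ (Fin 2 → ℂ)) (v : Fin 2 → ℂ) :
    fderiv ℝ (fun b => T (D.ωA (BallForms.expP b) (D.Φarch ℓ))) 0 (Complex.I • v) =
      Complex.I • fderiv ℝ (fun b => T (D.ωA (BallForms.expP b) (D.Φarch ℓ))) 0 v := by
  rw [hDω, hDΦ]
  exact hCR_lineOmega_zeroG V (cDiag Φ σ a ha ha0) (compat_plane V Φ σ a ha ha0) (compat_line₀ V Φ σ a ha ha0) (compat_line₁ V Φ σ a ha ha0)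
    (etaT₀ V (cDiag Φ σ a ha ha0).D η ν) (h₁W_cDiag Φ σ a ha ha0) (binvPi 1) (posIdxEquivUnit hpos) (negIdxEquivEmpty hpos) hemb T ℓ v

/-! ## §2 The two sockets: `harm` from the `v₁`-type of the knob, `hdef` from its definite types -/

include hemb in
/-- **SOCKET (χ)₀ ⇒ `harm`.**  If the knob character `η₀ := etaT₀ … η ν` has `v₁`-TYPE `m` on the `ι₁`-section frame of `Stab(x₀)` — `η₀((s(u))^𝔸, 1) =
(det A(u) · d(u))^m` — and `m + ℓ + e_P = 0`, `m + ℓ + e_Q = −1` (`ℓ := lambdaExponent`, the exponent of the see-saw factor at `v₁`; `(e_P, e_Q) :=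
lineVacExponentsZero`, the vacuum exponents of the line at `ι₁`, `e_P − e_Q = 1`), then the slot family of record satisfies the `harm` law of `distDatumAt`
(the archimedean factor acts on it through `(weightOf x₀)^∨` on `Stab(x₀)`).  This numerology is «`μ_∞` has weight one of the holomorphic type at `ι₁`» in
kernel currency. [cite: Liu2021, App. D Lem. D.2 (2)] [cite: KonnoKonno2007, Thm 5.4] -/
theorem harm_cDiag_of_archType {m : ℤ}
    (hηm : ∀ u : stabilizer U21 x₀,
      ((etaT₀ V (cDiag Φ σ a ha ha0).D η ν
          (UnitaryGroup.archToAdelic (↥(maximalRealSubfield L)) L (IsCMField.complexConj L) 3 (Matrix.diagonal (frameD V))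
            (archSectionFrameOf V (u : U21)), 1) : ℂˣ) : ℂ) =
        ((matA (stabilizerEquivK21.symm u)).det * sclD (stabilizerEquivK21.symm u)) ^ m)
    (hm : m + lambdaExponent V (cDiag Φ σ a ha ha0).D (compat_plane V Φ σ a ha ha0) (compat_line₀ V Φ σ a ha ha0) (compat_line₁ V Φ σ a ha ha0)
        (h₁W_cDiag Φ σ a ha ha0) +
      (lineVacExponentsZero V (cDiag Φ σ a ha ha0) (compat_line₀ V Φ σ a ha ha0) (h₁W_cDiag Φ σ a ha ha0) (posIdxEquivUnit hpos)
        (negIdxEquivEmpty hpos)).eP = 0)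
    (hm' : m + lambdaExponent V (cDiag Φ σ a ha ha0).D (compat_plane V Φ σ a ha ha0) (compat_line₀ V Φ σ a ha ha0) (compat_line₁ V Φ σ a ha ha0)
        (h₁W_cDiag Φ σ a ha ha0) +
      (lineVacExponentsZero V (cDiag Φ σ a ha ha0) (compat_line₀ V Φ σ a ha ha0) (h₁W_cDiag Φ σ a ha ha0) (posIdxEquivUnit hpos)
        (negIdxEquivEmpty hpos)).eQ = -1) :
    ∀ (u : ↥(stabilizer U21 x₀)) (ℓ : Module.Dual ℂ (Fin 2 → ℂ)),
      lineOmega_zero V (cDiag Φ σ a ha ha0).D (compat_plane V Φ σ a ha ha0) (compat_line₀ V Φ σ a ha ha0) (compat_line₁ V Φ σ a ha ha0)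
          (etaT₀ V (cDiag Φ σ a ha ha0).D η ν) (u : U21)
          (blockFamilyOfAt (L : Type) e₁ (frameD V) (frameD_real V) (frameD_ne V) (lineVec (L : Type) (dW (cDiag Φ σ a ha ha0).D 0))
            (fun _ => dW_real (cDiag Φ σ a ha ha0).D 0) (fun _ => dW_ne (cDiag Φ σ a ha ha0).D 0) ι₁ (blockPosEquiv V) (blockNegEquiv V)
            (posIdxEquivUnit hpos) (negIdxEquivEmpty hpos) (degOnePDual Empty) (binvPi 1) ℓ) =
        blockFamilyOfAt (L : Type) e₁ (frameD V) (frameD_real V) (frameD_ne V) (lineVec (L : Type) (dW (cDiag Φ σ a ha ha0).D 0))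
          (fun _ => dW_real (cDiag Φ σ a ha ha0).D 0) (fun _ => dW_ne (cDiag Φ σ a ha ha0).D 0) ι₁ (blockPosEquiv V) (blockNegEquiv V)
          (posIdxEquivUnit hpos) (negIdxEquivEmpty hpos) (degOnePDual Empty) (binvPi 1)
          ((BallForms.isPullbackCocycle_cotangentCocycle.weightOf x₀).dual u ℓ) :=
  harm_lineOmega_zeroG V (cDiag Φ σ a ha ha0) (compat_plane V Φ σ a ha ha0) (compat_line₀ V Φ σ a ha ha0) (compat_line₁ V Φ σ a ha ha0)
    (etaT₀ V (cDiag Φ σ a ha ha0).D η ν) (h₁W_cDiag Φ σ a ha ha0) (binvPi 1) hemb (posIdxEquivUnit hpos) (negIdxEquivEmpty hpos)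
    (hχ_zero_of_archType V (cDiag Φ σ a ha ha0).D (compat_plane V Φ σ a ha ha0) (compat_line₀ V Φ σ a ha ha0) (compat_line₁ V Φ σ a ha ha0)
      (etaT₀ V (cDiag Φ σ a ha ha0).D η ν) (h₁W_cDiag Φ σ a ha ha0)
      (lineVacExponentsZero V (cDiag Φ σ a ha ha0) (compat_line₀ V Φ σ a ha ha0) (h₁W_cDiag Φ σ a ha ha0) (posIdxEquivUnit hpos)
        (negIdxEquivEmpty hpos)) hηm hm hm')

/-- **SOCKET (def)₀ ⇒ `hdef`.**  If at every DEFINITE real place `b ≠ v₁` the knob character `η₀ := etaT₀ … η ν` has type `−a₀(b)` — `archScalar_zeroG … η₀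
(archSingle b u) · det(u)^(a₀ b) = 1` for the exponent table of record `a₀ := defExponentZero` (★ `defExponentZero_spec`: the definite Weil representation
acts on the slot family by `det^(a₀ b)`) — then the slot family of record satisfies the `hdef` law of `distDatumAt` (an archimedean `g ∈ U(V)(L ⊗ ℝ)` trivial
at `w(ι₁)` fixes `Φ_∞(ℓ) ⊗ Φ_f` under slot `0` of `lineRepOf`; ★ `harch_zero_of_defType_tmulG`).  This is «the Gaussian at the definite places is
`K_c`-fixed» ([Liu2021, Lem. D.2 (1)]) for the twisted datum. [cite: Liu2021, App. D Lem. D.2 (1)] -/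
theorem hdef_cDiag_of_defType
    (hdefT : ∀ b : {v : InfinitePlace ↥(maximalRealSubfield L) // v.IsReal}, b ≠ HypCensus.cmPlace (L : Type) ι₁ →
      ∀ u : UnitaryGroup.archLocal (L : Type) 3 (Matrix.diagonal (frameD V)) (cmPlaceOver (L : Type) b),
        ((archScalar_zeroG V (cDiag Φ σ a ha ha0).D (compat_plane V Φ σ a ha ha0) (compat_line₀ V Φ σ a ha ha0) (compat_line₁ V Φ σ a ha ha0)
            (etaT₀ V (cDiag Φ σ a ha ha0).D η ν)
            (UnitaryGroup.archSingle (↥(maximalRealSubfield L)) L (IsCMField.complexConj L) 3 (Matrix.diagonal (frameD V))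
              (IsCMField.complexConj_ne_one L) (NumberField.complexConj_smul_infinitePlace (L : Type)) (cmPlaceOver (L : Type) b) u) : ℂˣ) : ℂ) *
          (((u : UnitaryGroup.archLocal (L : Type) 3 (Matrix.diagonal (frameD V)) (cmPlaceOver (L : Type) b)) : GL (Fin 3) ℂ) :
              Matrix (Fin 3) (Fin 3) ℂ).det ^ defExponentZero V (cDiag Φ σ a ha ha0) (compat_line₀ V Φ σ a ha ha0) hpos b = 1) :
    ∀ g : UnitaryGroup.arch (↥(maximalRealSubfield L)) L (IsCMField.complexConj L) 3 V.Hm,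
      UnitaryGroup.archAt (↥(maximalRealSubfield L)) L (IsCMField.complexConj L) 3 V.Hm (UnitaryGroup.cmPlace (L : Type) ι₁)
          (NumberField.complexConj_smul_infinitePlace (L : Type) _) (IsCMField.complexConj_ne_one (L : Type)) g = 1 →
      ∀ (ℓ : Module.Dual ℂ (Fin 2 → ℂ)) (Φf : FinSB (↥(maximalRealSubfield L)) (Fin 3)),
        lineRepOf V (cDiag Φ σ a ha ha0).D (compat_plane V Φ σ a ha ha0) (compat_line₀ V Φ σ a ha ha0) (compat_line₁ V Φ σ a ha ha0)
            (compat_line₂ V Φ σ a ha ha0) (compat_line₃ V Φ σ a ha ha0) (etaT₀ V (cDiag Φ σ a ha ha0).D η ν)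
            (etaT₁ V (cDiag Φ σ a ha ha0).D η ν) (eta₂ V (cDiag Φ σ a ha ha0).D η) (eta₃ V (cDiag Φ σ a ha ha0).D η) 0
            (HodgeCM.Adelic.regimeEquiv L V.Hm hV
              (UnitaryGroup.archToAdelic (↥(maximalRealSubfield L)) L (IsCMField.complexConj L) 3 V.Hm g), 1)
            (piSchwartzBruhatEquiv (↥(maximalRealSubfield L)) (Fin 3)
              (blockFamilyOfAt (L : Type) e₁ (frameD V) (frameD_real V) (frameD_ne V) (lineVec (L : Type) (dW (cDiag Φ σ a ha ha0).D 0))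
                (fun _ => dW_real (cDiag Φ σ a ha ha0).D 0) (fun _ => dW_ne (cDiag Φ σ a ha ha0).D 0) ι₁ (blockPosEquiv V) (blockNegEquiv V)
                (posIdxEquivUnit hpos) (negIdxEquivEmpty hpos) (degOnePDual Empty) (binvPi 1) ℓ ⊗ₜ[ℂ] Φf)) =
          piSchwartzBruhatEquiv (↥(maximalRealSubfield L)) (Fin 3)
            (blockFamilyOfAt (L : Type) e₁ (frameD V) (frameD_real V) (frameD_ne V) (lineVec (L : Type) (dW (cDiag Φ σ a ha ha0).D 0))
                (fun _ => dW_real (cDiag Φ σ a ha ha0).D 0) (fun _ => dW_ne (cDiag Φ σ a ha ha0).D 0) ι₁ (blockPosEquiv V) (blockNegEquiv V)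
                (posIdxEquivUnit hpos) (negIdxEquivEmpty hpos) (degOnePDual Empty) (binvPi 1) ℓ ⊗ₜ[ℂ] Φf) :=
  harch_zero_of_defType_tmulG V (cDiag Φ σ a ha ha0).D (compat_plane V Φ σ a ha ha0) (compat_line₀ V Φ σ a ha ha0) (compat_line₁ V Φ σ a ha ha0)
    (compat_line₂ V Φ σ a ha ha0) (compat_line₃ V Φ σ a ha ha0) (etaT₀ V (cDiag Φ σ a ha ha0).D η ν) (etaT₁ V (cDiag Φ σ a ha ha0).D η ν)
    (eta₂ V (cDiag Φ σ a ha ha0).D η) (eta₃ V (cDiag Φ σ a ha ha0).D η) hV (posIdxEquivUnit hpos) (negIdxEquivEmpty hpos)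
    (defExponentZero V (cDiag Φ σ a ha ha0) (compat_line₀ V Φ σ a ha ha0) hpos)
    (defExponentZero_spec V (cDiag Φ σ a ha ha0) (compat_line₀ V Φ σ a ha ha0) hpos) hdefT

end Summit.HodgeConjecture.HodgeConjecture.Cruxes.H413.ThetaDistAtLine

end
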